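import Summits.NavierStokesRegularity.NavierStokesRegularity.Theorems.StretchingWellBindingEnstrophyQuarterLawDensitySieveEuclid
import Summits.NavierStokesRegularity.NavierStokesRegularity.Theorems.StretchingWellBindingEnstrophyQuarterLawStubFarFieldEnstrophy
import Summits.NavierStokesRegularity.NavierStokesRegularity.Theorems.StrongHypothesesBKMBoundBridge
import Summits.NavierStokesRegularity.NavierStokesRegularity.Theses.StretchingWellBinding
import Summits.NavierStokesRegularity.NavierStokesRegularity.Theses.TypeILiouville
import HarnessLib

/-!
# Shelf crux `EnstrophyQuarterLaw` (stmt-NavierStokesRegularity-1574): the DENSITY-SIEVE composition BY NAME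
# — `EnstrophyQuarterLaw ⟸ 0056 ∧ (L^{3,w} bound at first blow-ups) ∧ (slice ε-regularity on that stratum)`

Helper file (`--supports stmt-NavierStokesRegularity-1574 --as helper`; def-free; seat leafhand-ns-efficiencyfloor-4
g10). This is the Theorems-side COMPOSITION of an alternative line for the crux (a variant of the registered line
«sparse_sieve», whose open stub `stub_uniformSparseness` counts `L³`-MASS concentration balls and has no a-priori
source): the sieve's goodness test is replaced by the Choe–Wolf–Yang super-level-set DENSITY, for which the bad-ball
count is free on the stratum `ess sup_t ‖u(t)‖_{L^{3,w}} < ∞` (`…DensitySieveCount`, p832059). The theorem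
`enstrophyQuarterLaw_of_densitySieve` takes as HYPOTHESES, verbatim and in the crux's frame (every maximal smooth
Leray–Hopf rapidly-decaying-datum solution of finite lifespan):
* (F3) an `L^{3,w}` bound along the flow: `vol{‖u(t)‖ > h} ≤ (M/h)³` for all `t < T`, `h > 0` — OPEN (a Type-I-class
  hypothesis; regularity of `L^∞_t L^{3,w}_x` solutions without smallness is itself open);
* (F1) slice ε-regularity on that stratum: for each `ν, M` there are `ε, C` such that «`B(x,r)` not density-bad at
  time `t` (`r ≤ √t`) ⟹ `‖∇u(x,t)‖ ≤ C/r²`» — the quantitative content of [cite: ChoeWolfYang2019, Thm 1 via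
  Lemma 9 + Lemma 8 (19) + (26)] combined with an interior gradient estimate for bounded solutions; PRINT, not yet a
  Literature fact of the tree (to be typed; stated here only as a hypothesis);
* stmt-0056 `TypeIliouvilleNoTypeII` (sup-rate Type I at every first blow-up) — OPEN;
and concludes the crux `Theses.StretchingWellBinding.EnstrophyQuarterLaw` BY NAME. Landed inputs used: the far-field
enstrophy bound (`SparseSieve.Registered.stub_farFieldEnstrophy`, Tao 2013), Tao's bounded-Sobolev-norm class on closed
sub-slabs (`StrongHypotheses.hasBoundedSobolevNormsOn_of_classical_lerayHopf`) for the early times, and the density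
sieve (`setLIntegral_curl_sq_le_of_densitySieve`, p832339) for the near field at late times, glued by the
real-variable lemma `exists_rate_of_late_of_early`.

HONEST FRAMING: an implication between OPEN / unformalised statements and the crux; `EnstrophyQuarterLaw` (1574),
0056, (F1), (F3) all stay OPEN here; no registered stub is closed; nothing here bears on Navier–Stokes regularity
and no summit statement is proved. [folklore]
-/

noncomputable section

-- the summit and its single sub-problem share the name (CONVENTIONS §1), as in every Theorems file
set_option linter.dupNamespace false

namespace Summit.NavierStokesRegularity.NavierStokesRegularity.Theorems.EnstrophyQuarterLaw.DensitySieve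

open MeasureTheory Set Metric Filter Topology
open Literature.Analysis.FluidPDE
open scoped ENNReal NNReal

/-- Pointwise `|curl v|² ≤ 16 ‖∇v‖²` in `ℝ≥0∞` (`|curl v| ≤ 4‖∇v‖`, `norm_curl_le_four_mul`). [folklore] -/
theorem enorm_curl_sq_le_sixteen_mul (v : EuclideanSpace ℝ (Fin 3) → EuclideanSpace ℝ (Fin 3))
    (x : EuclideanSpace ℝ (Fin 3)) : ‖curl v x‖ₑ ^ 2 ≤ 16 * ‖fderiv ℝ v x‖ₑ ^ 2 := by
  rw [← ofReal_norm, ← ofReal_norm, ← ENNReal.ofReal_pow (norm_nonneg _),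
    ← ENNReal.ofReal_pow (norm_nonneg _), show (16 : ℝ≥0∞) = ENNReal.ofReal 16 by norm_num,
    ← ENNReal.ofReal_mul (by norm_num)]
  apply ENNReal.ofReal_le_ofReal
  have h4 := norm_curl_le_four_mul v x
  have h0 : 0 ≤ ‖curl v x‖ := norm_nonneg _
  nlinarith

/-- Early-time enstrophy bound from Tao's bounded-Sobolev-norm class: on a time set where
`∫ ‖D¹u(t)‖² ≤ C₁`, `∫ |curl u(t)|² ≤ 16 C₁`. [folklore] -/
theorem lintegral_curl_sq_le_of_hasBoundedSobolevNormsOn {S : Set ℝ}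
    {u : ℝ → EuclideanSpace ℝ (Fin 3) → EuclideanSpace ℝ (Fin 3)} (h : HasBoundedSobolevNormsOn S u) :
    ∃ B : ℝ, 0 ≤ B ∧ ∀ t ∈ S, ∫⁻ x, ‖curl (u t) x‖ₑ ^ 2 ≤ ENNReal.ofReal B := by
  obtain ⟨C₁, hC₁⟩ := h 1
  refine ⟨16 * C₁, by positivity, fun t ht => ?_⟩
  calc ∫⁻ x, ‖curl (u t) x‖ₑ ^ 2 ≤ ∫⁻ x, 16 * ‖fderiv ℝ (u t) x‖ₑ ^ 2 :=
        lintegral_mono fun x => enorm_curl_sq_le_sixteen_mul (u t) x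
    _ = 16 * ∫⁻ x, ‖iteratedFDeriv ℝ 1 (u t) x‖ₑ ^ 2 := by
        rw [lintegral_const_mul' _ _ (by norm_num)]
        congr 1
        refine lintegral_congr fun x => ?_
        rw [← ofReal_norm, ← ofReal_norm, norm_iteratedFDeriv_one]
    _ ≤ 16 * (C₁ : ℝ≥0∞) := by gcongr; exact hC₁ t ht
    _ = ENNReal.ofReal (16 * C₁) := by
        rw [ENNReal.ofReal_mul (by norm_num), ENNReal.ofReal_coe_nnreal]
        norm_num

/-- Real-variable glue: a late bound `P + Q/√(T − t)` on `[t₂, T)` and an early bound `B₁` on `[0, t₂]` give one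
rate constant `K = (P + B₁)√T + Q` on `[0, T)`. [folklore] -/
theorem exists_rate_of_late_of_early {T t₂ : ℝ} (hT : 0 < T) (Z : ℝ → ℝ≥0∞) {P Q B₁ : ℝ}
    (hP : 0 ≤ P) (hQ : 0 ≤ Q) (hB₁ : 0 ≤ B₁)
    (hlate : ∀ t ∈ Set.Ico t₂ T, Z t ≤ ENNReal.ofReal (P + Q / Real.sqrt (T - t)))
    (hearly : ∀ t ∈ Set.Icc 0 t₂, Z t ≤ ENNReal.ofReal B₁) :
    ∃ K : ℝ, ∀ t ∈ Set.Ico 0 T, Z t ≤ ENNReal.ofReal (K / Real.sqrt (T - t)) := by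
  refine ⟨(P + B₁) * Real.sqrt T + Q, fun t ht => ?_⟩
  have hst : 0 < Real.sqrt (T - t) := Real.sqrt_pos.2 (by linarith [ht.2])
  have hsT : Real.sqrt (T - t) ≤ Real.sqrt T := Real.sqrt_le_sqrt (by linarith [ht.1])
  have hkey : ∀ {a : ℝ}, 0 ≤ a → a ≤ a * Real.sqrt T / Real.sqrt (T - t) := fun {a} ha => by
    rw [le_div_iff₀ hst]
    exact mul_le_mul_of_nonneg_left hsT ha
  rcases lt_or_ge t t₂ with hlt | hge
  · refine (hearly t ⟨ht.1, hlt.le⟩).trans (ENNReal.ofReal_le_ofReal ?_)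
    calc B₁ ≤ B₁ * Real.sqrt T / Real.sqrt (T - t) := hkey hB₁
      _ ≤ ((P + B₁) * Real.sqrt T + Q) / Real.sqrt (T - t) := by
          gcongr
          nlinarith [Real.sqrt_nonneg T]
  · refine (hlate t ⟨hge, ht.2⟩).trans (ENNReal.ofReal_le_ofReal ?_)
    calc P + Q / Real.sqrt (T - t) ≤ P * Real.sqrt T / Real.sqrt (T - t) + Q / Real.sqrt (T - t) :=
          add_le_add (hkey hP) le_rfl
      _ = ((P + 0) * Real.sqrt T + Q) / Real.sqrt (T - t) := by ring
      _ ≤ ((P + B₁) * Real.sqrt T + Q) / Real.sqrt (T - t) := by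
          gcongr

/-- **THE DENSITY-SIEVE COMPOSITION BY NAME.** `(F3) ∧ (F1) ∧ 0056 ⟹ EnstrophyQuarterLaw` (stmt-1574), see the module
docstring for the three hypotheses. For one first blow-up: sup-rate Type I on `(l, T)` (0056), the far-field bound on
`[T/2, T)`, Tao's class on `[0, t₂]` (`t₂ = max((max l 0 + T)/2, T/2)`), and on `[t₂, T)` the near-field density
sieve at scales `≤ √t₂` with `U = max C 1 · (T − t)^{-1/2}`, whose bound is linear in `U`; glue. Conditional on OPEN
hypotheses; no summit statement is proved. [cite: ChoeWolfYang2019, Thm 1–2] -/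
theorem enstrophyQuarterLaw_of_densitySieve
    (hF3 : ∀ (ν T : ℝ), 0 < ν → 0 < T →
      ∀ (u : ℝ → EuclideanSpace ℝ (Fin 3) → EuclideanSpace ℝ (Fin 3)) (p : ℝ → EuclideanSpace ℝ (Fin 3) → ℝ),
      IsMaximalSmoothSolution ν 0 u p T → IsLerayHopfOn T ν 0 (u 0) u → HasRapidSpatialDecay (u 0) →
      ∃ M : ℝ, 0 ≤ M ∧ ∀ t ∈ Set.Ico 0 T, ∀ h : ℝ, 0 < h →
        volume {y | h < ‖u t y‖} ≤ ENNReal.ofReal ((M / h) ^ 3))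
    (hF1 : ∀ (ν M : ℝ), 0 < ν → 0 ≤ M → ∃ ε C : ℝ, 0 < ε ∧ ∀ (T : ℝ), 0 < T →
      ∀ (u : ℝ → EuclideanSpace ℝ (Fin 3) → EuclideanSpace ℝ (Fin 3)) (p : ℝ → EuclideanSpace ℝ (Fin 3) → ℝ),
      IsMaximalSmoothSolution ν 0 u p T → IsLerayHopfOn T ν 0 (u 0) u → HasRapidSpatialDecay (u 0) →
      (∀ t ∈ Set.Ico 0 T, ∀ h : ℝ, 0 < h → volume {y | h < ‖u t y‖} ≤ ENNReal.ofReal ((M / h) ^ 3)) →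
      ∀ t ∈ Set.Ioo 0 T, ∀ (x : EuclideanSpace ℝ (Fin 3)), ∀ r ∈ Set.Ioc 0 (Real.sqrt t),
        ¬ (ENNReal.ofReal (ε * r ^ 3) ≤ volume ({y | ε / r < ‖u t y‖} ∩ Metric.ball x r)) →
        ‖fderiv ℝ (u t) x‖ ≤ C / r ^ 2)
    (h56 : Summit.NavierStokesRegularity.NavierStokesRegularity.Theses.TypeILiouville.TypeIliouvilleNoTypeII) :
    Summit.NavierStokesRegularity.NavierStokesRegularity.Theses.StretchingWellBinding.EnstrophyQuarterLaw := by
  intro ν T hν hT u p hmax hLH hdec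
  -- (F3), (F1), 0056 for this solution
  obtain ⟨M, hM, htailM⟩ := hF3 ν T hν hT u p hmax hLH hdec
  obtain ⟨ε, Cr, hε, hreg⟩ := hF1 ν M hν hM
  have hregu := hreg T hT u p hmax hLH hdec htailM
  obtain ⟨C, hC⟩ := h56 ν T hν hT u p hmax hLH hdec
  obtain ⟨l, hl, hsub⟩ := mem_nhdsLT_iff_exists_Ioo_subset.1 hC
  -- far field on `[T/2, T)`
  obtain ⟨ρ, Bff, hBff0, hff⟩ := SparseSieve.Registered.stub_farFieldEnstrophy ν T hν hT u p hmax hLH hdec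
  -- the late window `[t₂, T)`
  set t₂ : ℝ := max ((max l 0 + T) / 2) (T / 2) with ht₂def
  have ht₂T : t₂ < T := by
    rw [ht₂def]; refine max_lt ?_ (by linarith)
    have := max_lt hl hT; linarith
  have ht₂0 : 0 < t₂ := lt_of_lt_of_le (by linarith) (le_max_right _ _)
  have ht₂l : l < t₂ := by
    have h1 : l ≤ max l 0 := le_max_left _ _
    have h2 : max l 0 < T := max_lt hl hT
    have : (max l 0 + T) / 2 ≤ t₂ := le_max_left _ _
    linarith
  have ht₂half : T / 2 ≤ t₂ := le_max_right _ _
  -- early times: Tao's class on `[0, t₂]`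
  obtain ⟨B₁, hB₁0, hearly⟩ := lintegral_curl_sq_le_of_hasBoundedSobolevNormsOn
    (Summit.NavierStokesRegularity.StrongHypotheses.hasBoundedSobolevNormsOn_of_classical_lerayHopf
      hν hmax.1 hLH hdec t₂ ht₂T)
  -- constants of the late bound
  set Cp : ℝ := max C 1 with hCpdef
  have hCp0 : 0 < Cp := lt_of_lt_of_le one_pos (le_max_right _ _)
  set r₀ : ℝ := Real.sqrt t₂ with hr₀def
  have hr₀ : 0 < r₀ := Real.sqrt_pos.2 ht₂0
  set ρ' : ℝ := max ρ 1 with hρ'def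
  set V : ℝ := (volume (Metric.ball (0 : EuclideanSpace ℝ (Fin 3)) ρ')).toReal with hVdef
  have hV0 : 0 ≤ V := ENNReal.toReal_nonneg
  have hVfin : volume (Metric.ball (0 : EuclideanSpace ℝ (Fin 3)) ρ') ≠ ∞ := measure_ball_lt_top.ne
  set v₁ : ℝ := (volume (Metric.ball (0 : EuclideanSpace ℝ (Fin 3)) 1)).toReal with hv₁def
  have hv₁0 : 0 ≤ v₁ := ENNReal.toReal_nonneg
  set a : ℝ := Cr ^ 2 / r₀ ^ 4 with hadef
  have ha0 : 0 ≤ a := by positivity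
  set b : ℝ := 16 * Cr ^ 2 * (8 * v₁ * M ^ 3 / ε ^ 4) with hbdef
  have hb0 : 0 ≤ b := by positivity
  set P : ℝ := 16 * (a * V + b / r₀) + Bff with hPdef
  have hP0 : 0 ≤ P := by positivity
  set Q : ℝ := 16 * (b * (2 * Cp / ε)) with hQdef
  have hQ0 : 0 ≤ Q := by positivity
  -- the late bound
  have hlate : ∀ t ∈ Set.Ico t₂ T,
      ∫⁻ x, ‖curl (u t) x‖ₑ ^ 2 ≤ ENNReal.ofReal (P + Q / Real.sqrt (T - t)) := by
    intro t ht
    have htT : t < T := ht.2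
    have ht0 : 0 < t := lt_of_lt_of_le ht₂0 ht.1
    have hst : 0 < Real.sqrt (T - t) := Real.sqrt_pos.2 (by linarith)
    set U : ℝ := Cp / Real.sqrt (T - t) with hUdef
    have hU : 0 < U := div_pos hCp0 hst
    -- sup bound from 0056
    have hsup : ∀ y, ‖u t y‖ ≤ U := fun y => by
      have h1 : ‖u t y‖ ≤ C / Real.sqrt (T - t) := hsub ⟨lt_of_lt_of_le ht₂l ht.1, htT⟩ y
      exact h1.trans (div_le_div_of_nonneg_right (le_max_left _ _) hst.le)
    -- weak-L³ tail at the heights ε/r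
    have htail : ∀ r ∈ Set.Ioc 0 r₀,
        volume {y | ε / r < ‖u t y‖} ≤ ENNReal.ofReal ((M * r / ε) ^ 3) := by
      intro r hr
      have h := htailM t ⟨ht0.le, htT⟩ (ε / r) (div_pos hε hr.1)
      have heq : M / (ε / r) = M * r / ε := by field_simp
      rwa [heq] at h
    -- slice ε-regularity at scales ≤ √t₂ ≤ √t
    have hreg' : ∀ (x : EuclideanSpace ℝ (Fin 3)), ∀ r ∈ Set.Ioc 0 r₀,
        ¬ (ENNReal.ofReal (ε * r ^ 3) ≤ volume ({y | ε / r < ‖u t y‖} ∩ Metric.ball x r)) →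
          ‖fderiv ℝ (u t) x‖ ≤ Cr / r ^ 2 := fun x r hr hgood =>
      hregu t ⟨ht0, htT⟩ x r ⟨hr.1, hr.2.trans (Real.sqrt_le_sqrt ht.1)⟩ hgood
    -- near field by the density sieve
    have hnear := setLIntegral_curl_sq_le_of_densitySieve (u t) hM hε hU hr₀ htail hsup hreg'
      (Metric.ball (0 : EuclideanSpace ℝ (Fin 3)) ρ') measurableSet_ball
    -- far field
    have hfar : ∫⁻ x in (Metric.ball (0 : EuclideanSpace ℝ (Fin 3)) ρ')ᶜ, ‖curl (u t) x‖ₑ ^ 2 ≤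
        ENNReal.ofReal Bff :=
      (lintegral_mono_set (Set.compl_subset_compl.2 (Metric.ball_subset_ball (le_max_left _ _)))).trans
        (hff t ⟨ht₂half.trans ht.1, htT⟩)
    -- add up
    rw [← lintegral_add_compl _ (measurableSet_ball (x := (0 : EuclideanSpace ℝ (Fin 3))) (ε := ρ'))]
    refine (add_le_add hnear hfar).trans ?_
    -- rewrite the near-field bound as `ofReal` of a real number
    have hVeq : volume (Metric.ball (0 : EuclideanSpace ℝ (Fin 3)) ρ') = ENNReal.ofReal V := by
      rw [hVdef, ENNReal.ofReal_toReal hVfin]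
    have h16 : (16 : ℝ≥0∞) = ENNReal.ofReal 16 := by norm_num
    rw [hVeq, ← ENNReal.ofReal_mul ha0, ← ENNReal.ofReal_add (by positivity) (by positivity), h16,
      ← ENNReal.ofReal_mul (by norm_num), ← ENNReal.ofReal_add (by positivity) hBff0]
    apply ENNReal.ofReal_le_ofReal
    have hexp : 16 * (a * V + b * (1 / r₀ + 2 * U / ε)) + Bff = P + Q / Real.sqrt (T - t) := by
      simp only [hPdef, hQdef, hUdef]
      field_simp
      ring
    rw [hexp]
  -- glue
  exact exists_rate_of_late_of_early hT (fun t => ∫⁻ x, ‖curl (u t) x‖ₑ ^ 2) hP0 hQ0 hB₁0 hlate hearly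

end Summit.NavierStokesRegularity.NavierStokesRegularity.Theorems.EnstrophyQuarterLaw.DensitySieve

end
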